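import Literature.Algebra.EuclideanLattices.ARVerifierMachine
import HarnessLib

/-!
# The Aharonov–Regev verifier machine computes `¬ MAccepts`: no register saturates (Regev 2009, Lemma 3.20)

Topic `Algebra/EuclideanLattices` (family `pqc`), sequel of `ARVerifierMachine.lean`. There the classical
post-processor `ARMachine.verdictF ∈ FP` of the machine form of Regev's Lemma 3.20 was written and its value on
`⟨codeOf I t d, encList cs⟩` was identified with the Boolean `Spec.verdict` of a SATURATED arithmetic (every
register capped at the width `W = 4096 (|z| + 2)⁴` of the yardstick). This file removes the saturations:
with `L = |z| + 2`, every intermediate integer of the computation (decoded sample entries `< 2^{9L}`,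
`B`, `t`, `num d`, `den d` `< 2^L`, `adj(−B)`, `det(−B)` `< 2^{4L²+4}`, then `B v`, `(B v)/D`, `adj(−B) a`,
the phases, the residuals, the Gram matrix `G Gᵀ`, its powers up to `2^{powSteps n}`, the trace, the two
powers `(100 num d)^{2·2^P}` and `(4N(den d · D)²)^{2^P}`) is below `2^{200 L³} < 2^W` (`Bounds.*`), so
that the machine's arithmetic is exact and `Spec.verdict` is literally `¬ ARVerifier.MAccepts B t d v` for
the decoded samples `v` (`verdict_iff`, with the identification of the pieces with the certificate
`ARVerifier.certOfVecs`: `aⱼ = (B vⱼ)/D`, `hⱼ = −gⱼ`, `e'ⱼ = −eⱼ`, `mⱼ`, `εⱼ = residual`,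
`∑ⱼ hⱼᵢ hⱼₖ = (G Gᵀ)ᵢₖ`, `tr((G Gᵀ)^{2^P}) = ∑ entries² of (G Gᵀ)^{2^{P−1}}`). Main theorems:

* `ARMachine.verdictF_eq_true_iff` / `ARMachine.verdictF_eq_false_iff` — for `1 ≤ n` and `N = nSamples n`
  raw codes `cs`, `verdictF ⟨codeOf I t d, encList cs⟩ = [true] ↔ ¬ MAccepts I.basis t d (j ↦ decodeIntVec n cⱼ)`
  and `= [false] ↔ MAccepts …`.

Everything is proved; no named facts.

## References

* O. Regev, *On lattices, learning with errors, random linear codes, and cryptography*, J. ACM 56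
  (2009), art. 34; author's version arXiv:2401.03703, Lemma 3.20 and its proof (p. 22). [Regev2009]
* D. Aharonov, O. Regev, *Lattice problems in NP ∩ coNP*, J. ACM 52 (2005) 749–765, §6. [AharonovRegev2005]
* S. Arora, B. Barak, *Computational Complexity: A Modern Approach*, CUP 2009, §1.3 (polynomially bounded
  registers). [AroraBarak2009]
-/

noncomputable section

namespace Literature.Algebra.EuclideanLattices

open _root_.Computability Literature.Computability.Complexity Literature.Computability.Complexity.Brick
open LLLMachine FarCertMachine Literature.Computability.Cryptography.SIS.OddPartFP Literature.LinearAlgebra.Matrix Finset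
open scoped Matrix

namespace ARMachine

/-! ### Generic bounds -/

/-- `|∑ᵢ fᵢ gᵢ| ≤ m · A · B` for `|fᵢ| ≤ A`, `|gᵢ| ≤ B`. [folklore] -/
theorem natAbs_sum_mul_le {m : ℕ} (f g : Fin m → ℤ) {A B : ℕ} (hf : ∀ i, (f i).natAbs ≤ A) (hg : ∀ i, (g i).natAbs ≤ B) :
    (∑ i, f i * g i).natAbs ≤ m * (A * B) := by
  calc (∑ i, f i * g i).natAbs ≤ ∑ i, (f i * g i).natAbs := Int.natAbs_sum_le _ _
    _ ≤ ∑ _i : Fin m, A * B := Finset.sum_le_sum fun i _ => by rw [Int.natAbs_mul]; exact Nat.mul_le_mul (hf i) (hg i)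
    _ = m * (A * B) := by rw [Finset.sum_const, Finset.card_univ, Fintype.card_fin, smul_eq_mul]

/-- `m · 2ᵃ · 2ᵇ ≤ 2ᶜ` when `m ≤ 2ˡ` and `l + a + b ≤ c`. [folklore] -/
theorem mul_two_pow_le {m l a b c : ℕ} (hm : m ≤ 2 ^ l) (h : l + a + b ≤ c) : m * (2 ^ a * 2 ^ b) ≤ 2 ^ c :=
  calc m * (2 ^ a * 2 ^ b) ≤ 2 ^ l * (2 ^ a * 2 ^ b) := Nat.mul_le_mul_right _ hm
    _ = 2 ^ (l + a + b) := by rw [pow_add, pow_add, mul_assoc]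
    _ ≤ 2 ^ c := Nat.pow_le_pow_right two_pos h

/-- `|round(p/q)| ≤ |p| + 1` for integers `p` and naturals `q`. [folklore] -/
theorem natAbs_round_div_le (p : ℤ) (q : ℕ) : (round ((p : ℚ) / (q : ℚ))).natAbs ≤ p.natAbs + 1 := by
  have h1 : |(p : ℚ) / q - round ((p : ℚ) / q)| ≤ 1 / 2 := abs_sub_round _
  have h2 : |(p : ℚ) / q| ≤ |(p : ℚ)| := by
    rw [abs_div]
    rcases Nat.eq_zero_or_pos q with hq | hq
    · simp [hq]
    · exact div_le_self (abs_nonneg _) (by rw [Nat.abs_cast]; exact_mod_cast hq)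
  have h3 : |((round ((p : ℚ) / q) : ℤ) : ℚ)| ≤ |(p : ℚ)| + 1 := by
    have := abs_sub_abs_le_abs_sub (((round ((p : ℚ) / q) : ℤ) : ℚ)) ((p : ℚ) / q)
    rw [abs_sub_comm] at this
    linarith
  have h4 : ((round ((p : ℚ) / q)).natAbs : ℚ) ≤ (p.natAbs : ℚ) + 1 := by
    rw [Nat.cast_natAbs, Nat.cast_natAbs, Int.cast_abs, Int.cast_abs]; exact h3
  exact_mod_cast h4

/-- **Entries of powers**: `|(M^q)ᵢₖ| ≤ (n m)^q` when `|Mᵢₖ| ≤ m`. [folklore] -/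
theorem natAbs_pow_entry_le {n : ℕ} (M : Matrix (Fin n) (Fin n) ℤ) {m : ℕ} (hM : ∀ i k, (M i k).natAbs ≤ m) :
    ∀ (q : ℕ) (i k : Fin n), ((M ^ q) i k).natAbs ≤ (n * m) ^ q
  | 0, i, k => by
    rw [pow_zero, pow_zero, Matrix.one_apply]
    split_ifs <;> simp
  | q + 1, i, k => by
    rw [pow_succ, Matrix.mul_apply]
    calc (∑ j, (M ^ q) i j * M j k).natAbs ≤ n * ((n * m) ^ q * m) :=
          natAbs_sum_mul_le _ _ (fun j => natAbs_pow_entry_le M hM q i j) (fun j => hM j k)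
      _ = (n * m) ^ (q + 1) := by ring

/-- An entry of the total decoder is below `2^{|canonIV c|}`. [folklore] -/
theorem natAbs_decodeIntVec_lt (n : ℕ) (c : List Bool) (i : Fin n) : (decodeIntVec n c i).natAbs < 2 ^ (canonIV c).length := by
  rw [decodeIntVec_eq]
  split_ifs with h
  · obtain ⟨-, h2⟩ := h
    have hlen : (i : ℕ) < (entriesOf n c).length := by rw [length_entriesOf]; exact i.isLt
    have hmem : (entriesOf n c).getD i 0 ∈ entriesOf (lenOf c) c := by
      rw [h2, List.getD_eq_getElem _ _ hlen]; exact List.getElem_mem _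
    exact (length_encodeNat_le_iff _ _).1 (length_encodeNat_natAbs_le c hmem)
  · simp

/-- `Nat.size n = Nat.log 2 n + 1` for `n ≥ 1`; hence `|bin n| = powSteps n`. [folklore] -/
theorem length_encodeNat_eq_powSteps {n : ℕ} (hn : 1 ≤ n) : (encodeNat n).length = ARVerifier.powSteps n := by
  rw [TM2Pass.length_encodeNat_eq_size, ARVerifier.powSteps]
  apply le_antisymm
  · exact Nat.size_le.2 (Nat.lt_pow_succ_log_self one_lt_two n)
  · exact Nat.lt_size.2 (Nat.pow_log_le_self 2 (by omega))

/-! ### The bounds on the input `⟨codeOf I t d, encList cs⟩` -/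

namespace Bounds

variable (I : LatticeInstance) (t : Fin I.n → ℤ) (d : ℚ) (cs : List (List Bool))

/-- `L = |z| + 2`. [folklore] -/
def L : ℕ := (inp I t d cs).length + 2

/-- `W = 4096 L⁴`. [folklore] -/
theorem Wd_eq_L : Wd I t d cs = 4096 * L I t d cs ^ 4 := Wd_eq I t d cs

/-- `2 ≤ L`. [folklore] -/
theorem two_le_L : 2 ≤ L I t d cs := by unfold L; omega

/-- `L ≤ L²`, `L ≤ L³`, `L² ≤ L³`, `L³ ≤ L⁴`. [folklore] -/
theorem L_pow_le : L I t d cs ≤ L I t d cs ^ 2 ∧ L I t d cs ≤ L I t d cs ^ 3 ∧ L I t d cs ^ 2 ≤ L I t d cs ^ 3 ∧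
    L I t d cs ^ 3 ≤ L I t d cs ^ 4 := by
  have h1 : 1 ≤ L I t d cs := le_trans (by norm_num) (two_le_L I t d cs)
  exact ⟨Nat.le_self_pow (by norm_num) _, Nat.le_self_pow (by norm_num) _, Nat.pow_le_pow_right h1 (by norm_num),
    Nat.pow_le_pow_right h1 (by norm_num)⟩

/-- `E = 4L² + 4`: the Faddeev–LeVerrier exponent (`RegevQuery.yardQ`). [folklore] -/
def E : ℕ := 4 * L I t d cs ^ 2 + 4

/-- The nine exponent budgets of the chain, all `≤ 200 L³`. [folklore] -/
theorem budgets :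
    19 * L I t d cs ≤ 200 * L I t d cs ^ 3 ∧
    E I t d cs + 20 * L I t d cs ≤ 200 * L I t d cs ^ 3 ∧
    2 * E I t d cs + 44 * L I t d cs + 12 ≤ 200 * L I t d cs ^ 3 ∧
    (2 * E I t d cs + 45 * L I t d cs + 12) * L I t d cs ≤ 81 * L I t d cs ^ 3 ∧
    2 * L I t d cs + 162 * L I t d cs ^ 3 ≤ 200 * L I t d cs ^ 3 ∧
    (2 * L I t d cs + 14) * (2 * L I t d cs) ≤ 200 * L I t d cs ^ 3 ∧
    (6 * L I t d cs + 2 * E I t d cs + 14) * (2 * L I t d cs) ≤ 200 * L I t d cs ^ 3 ∧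
    3 * E I t d cs + 22 * L I t d cs + 2 ≤ 200 * L I t d cs ^ 3 ∧
    E I t d cs ≤ 200 * L I t d cs ^ 3 := by
  have h2 := two_le_L I t d cs
  unfold E
  generalize L I t d cs = x at *
  have hxx : 2 * x ≤ x * x := Nat.mul_le_mul_right x h2
  have hxxx : 2 * (x * x) ≤ x * x * x := by nlinarith
  have e2 : x ^ 2 = x * x := by ring
  have e3 : x ^ 3 = x * x * x := by ring
  rw [e2, e3]
  refine ⟨by nlinarith, by nlinarith, by nlinarith, by nlinarith, by nlinarith, by nlinarith, by nlinarith, by nlinarith, by nlinarith⟩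

/-- All exponents of the chain are below `W`. [folklore] -/
theorem exp_lt_Wd {a : ℕ} (ha : a ≤ 200 * L I t d cs ^ 3) : a < Wd I t d cs := by
  obtain ⟨-, -, -, h34⟩ := L_pow_le I t d cs
  have h2 := two_le_L I t d cs
  have hpos : 0 < L I t d cs ^ 3 := pow_pos (by omega) 3
  rw [Wd_eq_L]
  omega

/-- `|x| ≤ L`. [folklore] -/
theorem length_codeOf_le_L : (codeOf I t d).length ≤ L I t d cs := by
  rw [L, inp, length_boolPair]; omega

/-- `n ≤ L`. [folklore] -/
theorem n_le_L : I.n ≤ L I t d cs := (RegevQuery.n_le_length_codeOf I t d).trans (length_codeOf_le_L I t d cs)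

/-- `n ≤ 2^L`. [folklore] -/
theorem n_le_two_pow_L : I.n ≤ 2 ^ L I t d cs := (n_le_L I t d cs).trans Nat.lt_two_pow_self.le

/-- `N ≤ 2^{4L+12}`. [folklore] -/
theorem nSamples_le_two_pow : ARVerifier.nSamples I.n ≤ 2 ^ (4 * L I t d cs + 12) := by
  have h1 : I.n + 1 ≤ 2 ^ L I t d cs := by
    have := n_le_L I t d cs
    exact le_trans (by omega) (Nat.lt_two_pow_self (n := L I t d cs))
  rw [ARVerifier.nSamples, pow_add, pow_mul, mul_comm]
  refine Nat.mul_le_mul ?_ (by norm_num)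
  calc (I.n + 1) ^ 4 ≤ (2 ^ L I t d cs) ^ 4 := Nat.pow_le_pow_left h1 4
    _ = (2 ^ 4) ^ L I t d cs := by rw [← pow_mul, ← pow_mul, mul_comm]

/-- Every raw code of the list is short: `|canonIV c| ≤ 9L`. [folklore] -/
theorem length_canonIV_le {c : List Bool} (hc : c ∈ cs) : (canonIV c).length ≤ 9 * L I t d cs := by
  have h1 : (canonIV c).length ≤ 9 * c.length + 6 := by
    have := CanonCode.length_canonPairFn_le_linear (ca := canonF) (cb := CanonCode.canonListFn CanonCode.canonIntFn)
      (A := 1) (B := 1) (A' := 8) (B' := 2) (fun u => by have := length_canonF_le u; omega)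
      (fun u => by
        rw [CanonCode.canonListFn_apply]
        have := CanonCode.length_listCanon_le (ci := CanonCode.canonIntFn) (A := 1) (B := 5)
          (fun u => by have := CanonCode.length_canonIntFn_le u; omega) u
        omega) c
    rw [canonIV]; omega
  have h2 : 2 * c.length + 2 ≤ (encList cs).length := two_mul_length_add_two_le_length_encList hc
  have h3 : (encList cs).length ≤ (inp I t d cs).length := by rw [inp, length_boolPair]; omega
  rw [L]; omega

/-- `|canonIV c| ≤ W` for every raw code of the list (the hypothesis of `verdictF_eq_spec`). [folklore] -/
theorem length_canonIV_le_Wd {c : List Bool} (hc : c ∈ cs) : (canonIV c).length ≤ Wd I t d cs :=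
  (exp_lt_Wd I t d cs ((length_canonIV_le I t d cs hc).trans (by
    have := (budgets I t d cs).1; omega))).le

/-- Entries of `B` are below `2^L`. [folklore] -/
theorem natAbs_basis_le (i k : Fin I.n) : (I.basis i k).natAbs ≤ 2 ^ L I t d cs :=
  ((RegevQuery.natAbs_basis_lt I t d i k).trans_le (Nat.pow_le_pow_right two_pos (length_codeOf_le_L I t d cs))).le

/-- Entries of `t` are below `2^L`. [folklore] -/
theorem natAbs_target_le (l : Fin I.n) : (t l).natAbs ≤ 2 ^ L I t d cs :=
  ((natAbs_target_lt I t d l).trans_le (Nat.pow_le_pow_right two_pos (length_codeOf_le_L I t d cs))).le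

/-- `|num d| < 2^L`. [folklore] -/
theorem natAbs_num_lt : d.num.natAbs < 2 ^ L I t d cs :=
  (Nat.size_le.1 ((FarCert.sizes_le_length_encode_gapCVP I t d).2.2.2.1)).trans_le
    (Nat.pow_le_pow_right two_pos (length_codeOf_le_L I t d cs))

/-- `den d < 2^L`. [folklore] -/
theorem den_lt : d.den < 2 ^ L I t d cs :=
  (Nat.size_le.1 ((FarCert.sizes_le_length_encode_gapCVP I t d).2.2.2.2)).trans_le
    (Nat.pow_le_pow_right two_pos (length_codeOf_le_L I t d cs))

/-- `4|x|² + 4 ≤ E`. [folklore] -/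
theorem yard_le_E : (RegevQuery.yardQ (codeOf I t d)).length ≤ E I t d cs := by
  rw [RegevQuery.length_yardQ, E]
  have := Nat.pow_le_pow_left (length_codeOf_le_L I t d cs) 2
  omega

/-- `adj(−B)` is below `2^E` (`RegevQuery.widthOK_codeOf`). [folklore] -/
theorem natAbs_adjugate_le (i k : Fin I.n) : ((-I.basis).adjugate i k).natAbs ≤ 2 ^ E I t d cs := by
  have h := (RegevQuery.widthOK_codeOf I t d).flMat_lt 0 i k
  rw [← adjugate_neg_eq_flMat_zero] at h
  exact h.le.trans (Nat.pow_le_pow_right two_pos (yard_le_E I t d cs))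

/-- `|det(−B)| ≤ 2^E` (for `n ≥ 1` it is `c₀` of the characteristic polynomial; for `n = 0` it is `1`). [folklore] -/
theorem natAbs_D_le : (Spec.D I.basis).natAbs ≤ 2 ^ E I t d cs := by
  rcases Nat.eq_zero_or_pos I.n with h0 | hpos
  · have : (Spec.D I.basis).natAbs ≤ 1 := by
      rw [Spec.D, Matrix.det_eq_one_of_card_eq_zero (by rw [Fintype.card_fin]; exact h0)]
      rfl
    exact this.trans Nat.one_le_two_pow
  · have h := (RegevQuery.widthOK_codeOf I t d).coeff_lt 0 hpos
    rw [charpoly_coeff_zero_eq_det_neg] at h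
    exact h.le.trans (Nat.pow_le_pow_right two_pos (yard_le_E I t d cs))

/-- The capped `adj(−B)` is `adj(−B)`. [folklore] -/
theorem Ad_eq : Spec.Ad (Wd I t d cs) I.basis = (-I.basis).adjugate := by
  funext l j
  exact capZ_of_lt ((natAbs_adjugate_le I t d cs l j).trans_lt (Nat.pow_lt_pow_right one_lt_two
    (exp_lt_Wd I t d cs (budgets I t d cs).2.2.2.2.2.2.2.2)))

variable {N : ℕ} (vs : Fin N → Fin I.n → ℤ) (hvs : ∀ j i, (vs j i).natAbs < 2 ^ (9 * L I t d cs))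

include hvs

/-- `u = B v` exactly, with `|uᵢ| ≤ 2^{19L}`. [folklore] -/
theorem u_eq (j : Fin N) : Spec.u (Wd I t d cs) I.basis (vs j) = I.basis *ᵥ vs j ∧
    ∀ i, ((I.basis *ᵥ vs j) i).natAbs ≤ 2 ^ (19 * L I t d cs) := by
  have hb : ∀ i, ((I.basis *ᵥ vs j) i).natAbs ≤ 2 ^ (19 * L I t d cs) := fun i => by
    rw [Matrix.mulVec, dotProduct]
    refine (natAbs_sum_mul_le _ _ (fun l => natAbs_basis_le I t d cs i l) (fun l => (hvs j l).le)).trans ?_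
    exact mul_two_pow_le (n_le_two_pow_L I t d cs) (by omega)
  exact ⟨funext fun i => capZ_of_lt ((hb i).trans_lt (Nat.pow_lt_pow_right one_lt_two
    (exp_lt_Wd I t d cs (budgets I t d cs).1))), hb⟩

/-- `a = (B v)/D` exactly, with `|aᵢ| ≤ 2^{19L}`. [folklore] -/
theorem a_eq (j : Fin N) : Spec.a (Wd I t d cs) I.basis (vs j) = (fun i => (I.basis *ᵥ vs j) i / Spec.D I.basis) ∧
    ∀ i, ((I.basis *ᵥ vs j) i / Spec.D I.basis).natAbs ≤ 2 ^ (19 * L I t d cs) := by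
  obtain ⟨hu, hub⟩ := u_eq I t d cs vs hvs j
  have hb : ∀ i, ((I.basis *ᵥ vs j) i / Spec.D I.basis).natAbs ≤ 2 ^ (19 * L I t d cs) := fun i =>
    (Int.natAbs_ediv_le_natAbs _ _).trans (hub i)
  refine ⟨funext fun i => ?_, hb⟩
  rw [Spec.a, hu]
  exact capZ_of_lt ((hb i).trans_lt (Nat.pow_lt_pow_right one_lt_two (exp_lt_Wd I t d cs (budgets I t d cs).1)))

/-- `h = adj(−B) a` exactly, with `|hᵢ| ≤ 2^{E + 20L}`. [folklore] -/
theorem h_eq (j : Fin N) : Spec.h (Wd I t d cs) I.basis (vs j) = (-I.basis).adjugate *ᵥ (fun i => (I.basis *ᵥ vs j) i / Spec.D I.basis) ∧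
    ∀ i, (((-I.basis).adjugate *ᵥ (fun i => (I.basis *ᵥ vs j) i / Spec.D I.basis)) i).natAbs ≤ 2 ^ (E I t d cs + 20 * L I t d cs) := by
  obtain ⟨ha, hab⟩ := a_eq I t d cs vs hvs j
  have hb : ∀ i, (((-I.basis).adjugate *ᵥ (fun i => (I.basis *ᵥ vs j) i / Spec.D I.basis)) i).natAbs ≤
      2 ^ (E I t d cs + 20 * L I t d cs) := fun i => by
    rw [Matrix.mulVec, dotProduct]
    refine (natAbs_sum_mul_le _ _ (fun l => natAbs_adjugate_le I t d cs i l) hab).trans ?_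
    exact mul_two_pow_le (n_le_two_pow_L I t d cs) (by omega)
  refine ⟨funext fun i => ?_, hb⟩
  rw [Spec.h, Ad_eq, ha]
  exact capZ_of_lt ((hb i).trans_lt (Nat.pow_lt_pow_right one_lt_two (exp_lt_Wd I t d cs (budgets I t d cs).2.1)))

/-- `|e'| ≤ 2^{E + 22L}`. [folklore] -/
theorem natAbs_e_le (j : Fin N) : (Spec.e (Wd I t d cs) I.basis t (vs j)).natAbs ≤ 2 ^ (E I t d cs + 22 * L I t d cs) := by
  obtain ⟨hh, hhb⟩ := h_eq I t d cs vs hvs j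
  rw [Spec.e, hh]
  refine (natAbs_sum_mul_le _ _ (natAbs_target_le I t d cs) hhb).trans ?_
  exact mul_two_pow_le (n_le_two_pow_L I t d cs) (by omega)

/-- `|m| ≤ 2^{2E + 22L} + 1`. [folklore] -/
theorem natAbs_m_le (j : Fin N) : (Spec.m (Wd I t d cs) I.basis t (vs j)).natAbs ≤ 2 ^ (2 * E I t d cs + 22 * L I t d cs) + 1 := by
  have he := natAbs_e_le I t d cs vs hvs j
  have hD := natAbs_D_le I t d cs
  have eexp : E I t d cs + 22 * L I t d cs + E I t d cs = 2 * E I t d cs + 22 * L I t d cs := by ring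
  rw [Spec.m]
  calc _ ≤ ((-Spec.e (Wd I t d cs) I.basis t (vs j)) * Spec.D I.basis).natAbs + 1 := natAbs_round_div_le _ _
    _ = (Spec.e (Wd I t d cs) I.basis t (vs j)).natAbs * (Spec.D I.basis).natAbs + 1 := by rw [Int.natAbs_mul, Int.natAbs_neg]
    _ ≤ 2 ^ (E I t d cs + 22 * L I t d cs) * 2 ^ E I t d cs + 1 := Nat.add_le_add_right (Nat.mul_le_mul he hD) 1
    _ = 2 ^ (2 * E I t d cs + 22 * L I t d cs) + 1 := by rw [← pow_add, eexp]

/-- `ε = −e' − m D` exactly (no saturation). [folklore] -/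
theorem r_eq (j : Fin N) : Spec.r (Wd I t d cs) I.basis t (vs j) =
    -Spec.e (Wd I t d cs) I.basis t (vs j) - Spec.m (Wd I t d cs) I.basis t (vs j) * Spec.D I.basis := by
  rw [Spec.r]
  refine capZ_of_lt ?_
  have he := natAbs_e_le I t d cs vs hvs j
  have hm := natAbs_m_le I t d cs vs hvs j
  have hD := natAbs_D_le I t d cs
  have h1 : (-Spec.e (Wd I t d cs) I.basis t (vs j) - Spec.m (Wd I t d cs) I.basis t (vs j) * Spec.D I.basis).natAbs ≤
      2 ^ (E I t d cs + 22 * L I t d cs) + (2 ^ (2 * E I t d cs + 22 * L I t d cs) + 1) * 2 ^ E I t d cs := by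
    refine (Int.natAbs_sub_le _ _).trans (Nat.add_le_add (by rwa [Int.natAbs_neg]) ?_)
    rw [Int.natAbs_mul]; exact Nat.mul_le_mul hm hD
  refine h1.trans_lt ?_
  have hW := exp_lt_Wd I t d cs (budgets I t d cs).2.2.2.2.2.2.2.1
  refine lt_of_lt_of_le ?_ (Nat.pow_le_pow_right two_pos hW.le)
  have e1 : 2 ^ (3 * E I t d cs + 22 * L I t d cs + 2) = 4 * (2 ^ (2 * E I t d cs + 22 * L I t d cs) * 2 ^ E I t d cs) := by
    rw [show 3 * E I t d cs + 22 * L I t d cs + 2 = (2 * E I t d cs + 22 * L I t d cs) + E I t d cs + 2 by ring, pow_add, pow_add]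
    ring
  have h2 : 2 ^ (E I t d cs + 22 * L I t d cs) ≤ 2 ^ (2 * E I t d cs + 22 * L I t d cs) * 2 ^ E I t d cs := by
    rw [← pow_add]; exact Nat.pow_le_pow_right two_pos (by omega)
  have h3 : 1 ≤ 2 ^ (2 * E I t d cs + 22 * L I t d cs) := Nat.one_le_two_pow
  have h4 : 1 ≤ 2 ^ E I t d cs := Nat.one_le_two_pow
  rw [e1]
  generalize 2 ^ (2 * E I t d cs + 22 * L I t d cs) = A at *
  generalize 2 ^ E I t d cs = B at *
  generalize 2 ^ (E I t d cs + 22 * L I t d cs) = C at *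
  nlinarith

/-- `U i j = hⱼ i` exactly. [folklore] -/
theorem U_eq : Spec.U (Wd I t d cs) I.basis vs = fun i j => Spec.h (Wd I t d cs) I.basis (vs j) i := by
  funext i j
  obtain ⟨hh, hhb⟩ := h_eq I t d cs vs hvs j
  rw [Spec.U, hh]
  exact capZ_of_lt ((hhb i).trans_lt (Nat.pow_lt_pow_right one_lt_two (exp_lt_Wd I t d cs (budgets I t d cs).2.1)))

/-- The exact Gram matrix `Mᵢₖ = ∑ⱼ hⱼᵢ hⱼₖ`. [folklore] -/
def gram : Matrix (Fin I.n) (Fin I.n) ℤ := fun i k => ∑ j, Spec.h (Wd I t d cs) I.basis (vs j) i * Spec.h (Wd I t d cs) I.basis (vs j) k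

omit hvs in
/-- The Gram matrix is symmetric. [folklore] -/
theorem gram_transpose : (gram I t d cs vs)ᵀ = gram I t d cs vs := by
  ext i k
  simp only [gram, Matrix.transpose_apply]
  exact Finset.sum_congr rfl fun j _ => mul_comm _ _

variable (hN : N = ARVerifier.nSamples I.n)
include hN

/-- `|Mᵢₖ| ≤ 2^F`, `F = 2E + 44L + 12`. [folklore] -/
theorem natAbs_gram_le (i k : Fin I.n) : (gram I t d cs vs i k).natAbs ≤ 2 ^ (2 * E I t d cs + 44 * L I t d cs + 12) := by
  have hb : ∀ j l, (Spec.h (Wd I t d cs) I.basis (vs j) l).natAbs ≤ 2 ^ (E I t d cs + 20 * L I t d cs) := fun j l => by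
    obtain ⟨hh, hhb⟩ := h_eq I t d cs vs hvs j
    rw [hh]; exact hhb l
  have hNle : N ≤ 2 ^ (4 * L I t d cs + 12) := by rw [hN]; exact nSamples_le_two_pow I t d cs
  rw [gram]
  refine (natAbs_sum_mul_le _ _ (fun j => hb j i) (fun j => hb j k)).trans ?_
  exact mul_two_pow_le hNle (by omega)

/-- `M = G Gᵀ` exactly. [folklore] -/
theorem M_eq : Spec.M (Wd I t d cs) I.basis vs = gram I t d cs vs := by
  funext i k
  rw [Spec.M, U_eq I t d cs vs hvs]
  exact capZ_of_lt ((natAbs_gram_le I t d cs vs hvs hN i k).trans_lt (Nat.pow_lt_pow_right one_lt_two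
    (exp_lt_Wd I t d cs (budgets I t d cs).2.2.1)))

/-- Powers of the Gram matrix up to the `n`-th have entries below `2^{81 L³}`. [folklore] -/
theorem natAbs_gram_pow_le {q : ℕ} (hq : q ≤ I.n) (i k : Fin I.n) :
    ((gram I t d cs vs ^ q) i k).natAbs ≤ 2 ^ (81 * L I t d cs ^ 3) := by
  have h := natAbs_pow_entry_le (gram I t d cs vs) (natAbs_gram_le I t d cs vs hvs hN) q i k
  refine h.trans ?_
  have eexp : L I t d cs + (2 * E I t d cs + 44 * L I t d cs + 12) = 2 * E I t d cs + 45 * L I t d cs + 12 := by ring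
  have hnm : I.n * 2 ^ (2 * E I t d cs + 44 * L I t d cs + 12) ≤ 2 ^ (2 * E I t d cs + 45 * L I t d cs + 12) := by
    calc I.n * 2 ^ (2 * E I t d cs + 44 * L I t d cs + 12) ≤ 2 ^ L I t d cs * 2 ^ (2 * E I t d cs + 44 * L I t d cs + 12) :=
          Nat.mul_le_mul_right _ (n_le_two_pow_L I t d cs)
      _ = 2 ^ (2 * E I t d cs + 45 * L I t d cs + 12) := by rw [← pow_add, eexp]
  calc (I.n * 2 ^ (2 * E I t d cs + 44 * L I t d cs + 12)) ^ q ≤ (2 ^ (2 * E I t d cs + 45 * L I t d cs + 12)) ^ q :=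
        Nat.pow_le_pow_left hnm q
    _ ≤ (2 ^ (2 * E I t d cs + 45 * L I t d cs + 12)) ^ L I t d cs :=
        Nat.pow_le_pow_right (by positivity) (hq.trans (n_le_L I t d cs))
    _ = 2 ^ ((2 * E I t d cs + 45 * L I t d cs + 12) * L I t d cs) := by rw [← pow_mul]
    _ ≤ 2 ^ (81 * L I t d cs ^ 3) := Nat.pow_le_pow_right two_pos (budgets I t d cs).2.2.2.1

omit hvs hN in
/-- `2^{P−1} ≤ n` and `2^P ≤ 2n` for `P = |bin n|`, `n ≥ 1`. [folklore] -/
theorem two_pow_P_le' (hn : 1 ≤ I.n) : 2 ^ ((encodeNat I.n).length - 1) ≤ I.n ∧ 2 ^ (encodeNat I.n).length ≤ 2 * I.n := by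
  have h1 : 2 ^ ((encodeNat I.n).length - 1) ≤ I.n := by
    rw [length_encodeNat_eq_powSteps hn, ARVerifier.powSteps, Nat.add_sub_cancel]
    exact Nat.pow_log_le_self 2 (by omega)
  refine ⟨h1, ?_⟩
  have hP : (encodeNat I.n).length = (encodeNat I.n).length - 1 + 1 := by
    rw [length_encodeNat_eq_powSteps hn, ARVerifier.powSteps]; omega
  rw [hP, pow_succ]; omega

/-- `M' = (G Gᵀ)^{2^{P−1}}` exactly (`P = |bin n|`; `2^{P−1} ≤ n`). [folklore] -/
theorem Mp_eq (hn : 1 ≤ I.n) : Spec.Mp (Wd I t d cs) I.basis vs = gram I t d cs vs ^ 2 ^ ((encodeNat I.n).length - 1) := by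
  rw [Spec.Mp, M_eq I t d cs vs hvs hN]
  refine iterate_sqStep_eq_pow _ (gram_transpose I t d cs vs) _ fun j hj a b => ?_
  have hq : 2 ^ j ≤ I.n := (Nat.pow_le_pow_right two_pos hj).trans (two_pow_P_le' I hn).1
  refine (natAbs_gram_pow_le I t d cs vs hvs hN hq a b).trans_lt (Nat.pow_lt_pow_right one_lt_two (exp_lt_Wd I t d cs ?_))
  exact Nat.mul_le_mul_right _ (by norm_num)

/-- `tr = ∑ᵢ ∑ₗ M'ᵢₗ²` exactly. [folklore] -/
theorem tr_eq (hn : 1 ≤ I.n) : Spec.tr (Wd I t d cs) I.basis vs =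
    ∑ i, ∑ l, (gram I t d cs vs ^ 2 ^ ((encodeNat I.n).length - 1)) i l * (gram I t d cs vs ^ 2 ^ ((encodeNat I.n).length - 1)) i l := by
  rw [Spec.tr, Mp_eq I t d cs vs hvs hN hn]
  refine capZ_of_lt ?_
  have hb := natAbs_gram_pow_le I t d cs vs hvs hN (two_pow_P_le' I hn).1
  have h1 : (∑ i, ∑ l, (gram I t d cs vs ^ 2 ^ ((encodeNat I.n).length - 1)) i l *
      (gram I t d cs vs ^ 2 ^ ((encodeNat I.n).length - 1)) i l).natAbs ≤ I.n * (I.n * (2 ^ (81 * L I t d cs ^ 3) * 2 ^ (81 * L I t d cs ^ 3))) := by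
    calc _ ≤ ∑ i, (∑ l, (gram I t d cs vs ^ 2 ^ ((encodeNat I.n).length - 1)) i l *
          (gram I t d cs vs ^ 2 ^ ((encodeNat I.n).length - 1)) i l).natAbs := Int.natAbs_sum_le _ _
      _ ≤ ∑ _i : Fin I.n, I.n * (2 ^ (81 * L I t d cs ^ 3) * 2 ^ (81 * L I t d cs ^ 3)) :=
          Finset.sum_le_sum fun i _ => natAbs_sum_mul_le _ _ (hb i) (hb i)
      _ = _ := by rw [Finset.sum_const, Finset.card_univ, Fintype.card_fin, smul_eq_mul]
  refine h1.trans_lt ?_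
  have eexp : L I t d cs + (L I t d cs + (81 * L I t d cs ^ 3 + 81 * L I t d cs ^ 3)) = 2 * L I t d cs + 162 * L I t d cs ^ 3 := by ring
  have h2 : I.n * (I.n * (2 ^ (81 * L I t d cs ^ 3) * 2 ^ (81 * L I t d cs ^ 3))) ≤ 2 ^ (2 * L I t d cs + 162 * L I t d cs ^ 3) := by
    have hn2 := n_le_two_pow_L I t d cs
    calc I.n * (I.n * (2 ^ (81 * L I t d cs ^ 3) * 2 ^ (81 * L I t d cs ^ 3)))
        ≤ 2 ^ L I t d cs * (2 ^ L I t d cs * (2 ^ (81 * L I t d cs ^ 3) * 2 ^ (81 * L I t d cs ^ 3))) :=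
          Nat.mul_le_mul hn2 (Nat.mul_le_mul_right _ hn2)
      _ = 2 ^ (2 * L I t d cs + 162 * L I t d cs ^ 3) := by rw [← pow_add, ← pow_add, ← pow_add, eexp]
  exact h2.trans_lt (Nat.pow_lt_pow_right one_lt_two (exp_lt_Wd I t d cs (budgets I t d cs).2.2.2.2.1))

omit hvs hN in
/-- `αP = (100 num d)^{2·2^P}` exactly. [folklore] -/
theorem alphaP_eq (hn : 1 ≤ I.n) : Spec.alphaP (n := I.n) (Wd I t d cs) d = (100 * d.num) ^ (2 * 2 ^ (encodeNat I.n).length) := by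
  have hm : ((100 * d.num.natAbs : ℕ) : ℤ) = |100 * d.num| := by
    rw [Nat.cast_mul, Nat.cast_natAbs, abs_mul, abs_of_pos (by norm_num : (0:ℤ) < 100)]; norm_num
  have e1 : ((100 * d.num.natAbs * (100 * d.num.natAbs) : ℕ) : ℤ) = (100 * d.num) ^ 2 := by
    rw [Nat.cast_mul, hm, abs_mul_abs_self, pow_two]
  rw [Spec.alphaP, iterate_sqZ_eq_pow, e1, ← pow_mul]
  have hnum : 100 * d.num.natAbs ≤ 2 ^ (L I t d cs + 7) := by
    have := natAbs_num_lt I t d cs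
    calc 100 * d.num.natAbs ≤ 128 * d.num.natAbs := Nat.mul_le_mul_right _ (by norm_num)
      _ ≤ 128 * 2 ^ L I t d cs := Nat.mul_le_mul_left _ this.le
      _ = 2 ^ (L I t d cs + 7) := by rw [pow_add, show (2:ℕ) ^ 7 = 128 by norm_num, mul_comm]
  have eexp : (L I t d cs + 7 + (L I t d cs + 7)) * (2 * I.n) = (2 * L I t d cs + 14) * (2 * I.n) := by ring
  rw [Int.natAbs_natCast]
  calc (100 * d.num.natAbs * (100 * d.num.natAbs)) ^ 2 ^ (encodeNat I.n).length
      ≤ (2 ^ (L I t d cs + 7) * 2 ^ (L I t d cs + 7)) ^ (2 * I.n) :=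
        (Nat.pow_le_pow_left (Nat.mul_le_mul hnum hnum) _).trans (Nat.pow_le_pow_right (by positivity) (two_pow_P_le' I hn).2)
    _ = 2 ^ ((2 * L I t d cs + 14) * (2 * I.n)) := by rw [← pow_add, ← pow_mul, eexp]
    _ < 2 ^ Wd I t d cs := Nat.pow_lt_pow_right one_lt_two (exp_lt_Wd I t d cs (le_trans
        (Nat.mul_le_mul_left _ (Nat.mul_le_mul_left 2 (n_le_L I t d cs))) (budgets I t d cs).2.2.2.2.2.1))

omit hvs in
/-- `βP = (4 N (den d · D)²)^{2^P}` exactly. [folklore] -/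
theorem betaP_eq (hn : 1 ≤ I.n) : Spec.betaP (N := N) (Wd I t d cs) I.basis d =
    (((4 * N : ℕ) : ℤ) * ((d.den : ℤ) * Spec.D I.basis * ((d.den : ℤ) * Spec.D I.basis))) ^ 2 ^ (encodeNat I.n).length := by
  rw [Spec.betaP, iterate_sqZ_eq_pow]
  have h4N : 4 * N ≤ 2 ^ (4 * L I t d cs + 14) := by
    calc 4 * N = 4 * ARVerifier.nSamples I.n := by rw [hN]
      _ ≤ 4 * 2 ^ (4 * L I t d cs + 12) := Nat.mul_le_mul_left 4 (nSamples_le_two_pow I t d cs)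
      _ = 2 ^ (4 * L I t d cs + 14) := by rw [show 4 * L I t d cs + 14 = (4 * L I t d cs + 12) + 2 by ring, pow_succ, pow_succ]; ring
  have hdD : ((d.den : ℤ) * Spec.D I.basis).natAbs ≤ 2 ^ (L I t d cs + E I t d cs) := by
    rw [Int.natAbs_mul, Int.natAbs_natCast, pow_add]
    exact Nat.mul_le_mul (den_lt I t d cs).le (natAbs_D_le I t d cs)
  have eexp : 4 * L I t d cs + 14 + (L I t d cs + E I t d cs + (L I t d cs + E I t d cs)) = 6 * L I t d cs + 2 * E I t d cs + 14 := by ring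
  have hbase : (((4 * N : ℕ) : ℤ) * ((d.den : ℤ) * Spec.D I.basis * ((d.den : ℤ) * Spec.D I.basis))).natAbs ≤
      2 ^ (6 * L I t d cs + 2 * E I t d cs + 14) := by
    rw [Int.natAbs_mul, Int.natAbs_mul, Int.natAbs_natCast]
    calc 4 * N * (((d.den : ℤ) * Spec.D I.basis).natAbs * ((d.den : ℤ) * Spec.D I.basis).natAbs)
        ≤ 2 ^ (4 * L I t d cs + 14) * (2 ^ (L I t d cs + E I t d cs) * 2 ^ (L I t d cs + E I t d cs)) :=
          Nat.mul_le_mul h4N (Nat.mul_le_mul hdD hdD)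
      _ = 2 ^ (6 * L I t d cs + 2 * E I t d cs + 14) := by rw [← pow_add, ← pow_add, eexp]
  calc _ ≤ (2 ^ (6 * L I t d cs + 2 * E I t d cs + 14)) ^ (2 * I.n) :=
        (Nat.pow_le_pow_left hbase _).trans (Nat.pow_le_pow_right (by positivity) (two_pow_P_le' I hn).2)
    _ = 2 ^ ((6 * L I t d cs + 2 * E I t d cs + 14) * (2 * I.n)) := by rw [← pow_mul]
    _ < 2 ^ Wd I t d cs := Nat.pow_lt_pow_right one_lt_two (exp_lt_Wd I t d cs (le_trans
        (Nat.mul_le_mul_left _ (Nat.mul_le_mul_left 2 (n_le_L I t d cs))) (budgets I t d cs).2.2.2.2.2.2.1))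

end Bounds

/-! ### The identification with `MAccepts` -/

section Identify

open ARVerifier

variable (I : LatticeInstance) (t : Fin I.n → ℤ) (d : ℚ) (cs : List (List Bool))
variable (vs : Fin (nSamples I.n) → Fin I.n → ℤ) (hvs : ∀ j i, (vs j i).natAbs < 2 ^ (9 * Bounds.L I t d cs))

include hvs

/-- `hⱼ = −gⱼ` (the numerator `dualNum` of the dual sample). [folklore] -/
theorem h_eq_neg_dualNum (j : Fin (nSamples I.n)) :
    Spec.h (Wd I t d cs) I.basis (vs j) = -(certOfVecs I.basis t vs).dualNum j := by
  rw [(Bounds.h_eq I t d cs vs hvs j).1, Cert.dualNum, certOfVecs_C, certOfVecs_A, Matrix.neg_mulVec, neg_neg]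
  rfl

/-- `e'ⱼ = −eⱼ` (`phaseNum`). [folklore] -/
theorem e_eq_neg_phaseNum (j : Fin (nSamples I.n)) :
    Spec.e (Wd I t d cs) I.basis t (vs j) = -(certOfVecs I.basis t vs).phaseNum t j := by
  rw [Spec.e, h_eq_neg_dualNum I t d cs vs hvs j, Cert.phaseNum, dotProduct, ← Finset.sum_neg_distrib]
  exact Finset.sum_congr rfl fun l _ => by simp [mul_neg]

/-- `mⱼ` is the rounded phase of the certificate (`D ≠ 0`). [folklore] -/
theorem m_eq (hD : Spec.D I.basis ≠ 0) (j : Fin (nSamples I.n)) :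
    Spec.m (Wd I t d cs) I.basis t (vs j) = (certOfVecs I.basis t vs).m j := by
  rw [Spec.m, e_eq_neg_phaseNum I t d cs vs hvs j, neg_neg, certOfVecs_m, certOfVecs_D]
  congr 1
  have hD' : ((-I.basis).det : ℚ) ≠ 0 := by exact_mod_cast hD
  have hcast : ((((Spec.D I.basis)).natAbs * ((Spec.D I.basis)).natAbs : ℕ) : ℚ) = ((-I.basis).det : ℚ) * ((-I.basis).det : ℚ) := by
    rw [Nat.cast_mul, Nat.cast_natAbs, Int.cast_abs, ← abs_mul, abs_mul_self, Spec.D]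
  rw [hcast, Int.cast_mul, Spec.D, mul_div_mul_right _ _ hD']

/-- `εⱼ = residual` (`D ≠ 0`). [folklore] -/
theorem r_eq_residual (hD : Spec.D I.basis ≠ 0) (j : Fin (nSamples I.n)) :
    Spec.r (Wd I t d cs) I.basis t (vs j) = (certOfVecs I.basis t vs).residual t j := by
  rw [Bounds.r_eq I t d cs vs hvs j, m_eq I t d cs vs hvs hD j, e_eq_neg_phaseNum I t d cs vs hvs j, neg_neg, Cert.residual,
    certOfVecs_D, Spec.D]

/-- The Gram matrix is `G Gᵀ` of the certificate's sample matrix. [folklore] -/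
theorem gram_eq_sampleMat : Bounds.gram I t d cs vs = (certOfVecs I.basis t vs).sampleMat * (certOfVecs I.basis t vs).sampleMatᵀ := by
  ext i k
  simp only [Bounds.gram, Matrix.mul_apply, Matrix.transpose_apply, Cert.sampleMat_apply, h_eq_neg_dualNum I t d cs vs hvs,
    Pi.neg_apply, neg_mul_neg]

omit hvs in
/-- Trace of an even power of a symmetric matrix as a sum of squares of entries of the half power. [folklore] -/
theorem trace_pow_two_mul {n : ℕ} (M : Matrix (Fin n) (Fin n) ℤ) (hM : Mᵀ = M) (q : ℕ) :
    Matrix.trace (M ^ (2 * q)) = ∑ i, ∑ l, (M ^ q) i l * (M ^ q) i l := by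
  rw [two_mul, pow_add, Matrix.trace]
  refine Finset.sum_congr rfl fun i _ => ?_
  rw [Matrix.diag_apply, Matrix.mul_apply]
  refine Finset.sum_congr rfl fun l _ => ?_
  congr 1
  rw [← Matrix.transpose_apply (M ^ q) i l, Matrix.transpose_pow, hM]

/-- **The saturated verdict is `¬ MAccepts`** on decoded samples of the right size (`1 ≤ n`).
[cite: Regev2009, Lemma 3.20 (proof, p. 22)] [cite: AharonovRegev2005, §6 — variant] -/
theorem verdict_iff (hn : 1 ≤ I.n) :
    Spec.verdict (Wd I t d cs) I.basis t d vs = true ↔ ¬ MAccepts I.basis t d vs := by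
  have hP : (encodeNat I.n).length = powSteps I.n := length_encodeNat_eq_powSteps hn
  -- the conjunction of the three tests is `MAccepts`
  have key : (decide (Spec.D I.basis ≠ 0) && (decide (((nSamples I.n : ℕ) : ℤ) * (Spec.D I.basis * Spec.D I.basis) ≤
      50 * Spec.S (Wd I t d cs) I.basis t vs) && decide (Spec.alphaP (n := I.n) (Wd I t d cs) d * Spec.tr (Wd I t d cs) I.basis vs ≤
      Spec.betaP (N := nSamples I.n) (Wd I t d cs) I.basis d))) = true ↔ MAccepts I.basis t d vs := by
    rw [Bool.and_eq_true, Bool.and_eq_true, decide_eq_true_iff, decide_eq_true_iff, decide_eq_true_iff]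
    by_cases hD : Spec.D I.basis = 0
    · constructor
      · rintro ⟨h, -⟩; exact absurd hD h
      · intro h; exact absurd hD h.1
    have hS : Spec.S (Wd I t d cs) I.basis t vs = ∑ j, (certOfVecs I.basis t vs).residual t j ^ 2 := by
      rw [Spec.S]
      exact Finset.sum_congr rfl fun j _ => by rw [r_eq_residual I t d cs vs hvs hD j, pow_two]
    have htr : Spec.alphaP (n := I.n) (Wd I t d cs) d * Spec.tr (Wd I t d cs) I.basis vs =
        (100 * d.num) ^ (2 * 2 ^ powSteps I.n) *
          Matrix.trace (((certOfVecs I.basis t vs).sampleMat * (certOfVecs I.basis t vs).sampleMatᵀ) ^ 2 ^ powSteps I.n) := by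
      rw [Bounds.alphaP_eq I t d cs hn, Bounds.tr_eq I t d cs vs hvs rfl hn, ← gram_eq_sampleMat I t d cs vs hvs, hP]
      have h2 : 2 ^ powSteps I.n = 2 * 2 ^ (powSteps I.n - 1) := by
        rw [← pow_succ']; congr 1; have := one_le_powSteps I.n; omega
      rw [h2, trace_pow_two_mul _ (Bounds.gram_transpose I t d cs vs)]
    have hβ : Spec.betaP (N := nSamples I.n) (Wd I t d cs) I.basis d =
        (4 * (nSamples I.n : ℤ) * ((d.den : ℤ) * (certOfVecs I.basis t vs).D) ^ 2) ^ 2 ^ powSteps I.n := by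
      rw [Bounds.betaP_eq I t d cs rfl hn, hP, certOfVecs_D]
      congr 1
      rw [Spec.D]; push_cast; ring
    have hD2 : Spec.D I.basis * Spec.D I.basis = (certOfVecs I.basis t vs).D ^ 2 := by rw [certOfVecs_D, Spec.D, pow_two]
    rw [hS, htr, hβ, hD2]
    unfold MAccepts
    simp only [Spec.D, certOfVecs_D, ne_eq]
  -- `verdict = !(…)`
  rw [Spec.verdict, ← key]
  cases (decide (Spec.D I.basis ≠ 0) && (decide (((nSamples I.n : ℕ) : ℤ) * (Spec.D I.basis * Spec.D I.basis) ≤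
      50 * Spec.S (Wd I t d cs) I.basis t vs) && decide (Spec.alphaP (n := I.n) (Wd I t d cs) d * Spec.tr (Wd I t d cs) I.basis vs ≤
      Spec.betaP (N := nSamples I.n) (Wd I t d cs) I.basis d))) <;> simp

end Identify

/-! ### The value of the verdict machine -/

section Main

variable (I : LatticeInstance) (t : Fin I.n → ℤ) (d : ℚ) (cs : List (List Bool)) (hn : 1 ≤ I.n)
  (hcs : cs.length = ARVerifier.nSamples I.n)

include hn hcs

/-- The machine's verdict is the Boolean `[¬ MAccepts]` (as an `iff` with `true`). [cite: Regev2009, Lemma 3.20 (proof, p. 22)] -/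
theorem verdictF_eq_singleton :
    ∃ b : Bool, verdictF (boolPair (codeOf I t d) (encList cs)) = [b] ∧
      (b = true ↔ ¬ ARVerifier.MAccepts I.basis t d (fun j : Fin (ARVerifier.nSamples I.n) => decodeIntVec I.n (cs.getD j []))) := by
  have h := verdictF_eq_spec I t d cs hcs (fun c hc => Bounds.length_canonIV_le_Wd I t d cs hc)
  refine ⟨_, h, ?_⟩
  refine verdict_iff I t d cs _ (fun j i => ?_) hn
  have hmem : cs.getD j [] ∈ cs := by
    rw [List.getD_eq_getElem _ _ (by rw [hcs]; exact j.isLt)]; exact List.getElem_mem _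
  exact (natAbs_decodeIntVec_lt I.n _ i).trans_le (Nat.pow_le_pow_right two_pos (Bounds.length_canonIV_le I t d cs hmem))

/-- **The verdict machine accepts iff the Aharonov–Regev verifier rejects the decoded samples.** For an
instance `((B, t), d)` of dimension `n ≥ 1` and a coded list of `N = nSamples n` arbitrary strings `cⱼ`, read
as the integer vectors `vⱼ = decodeIntVec n cⱼ`: `verdictF ⟨codeOf I t d, encList cs⟩ = [true] ↔ ¬ MAccepts B t d v`.
[cite: Regev2009, Lemma 3.20 (proof, p. 22)] [cite: AharonovRegev2005, §6 — variant] -/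
theorem verdictF_eq_true_iff :
    verdictF (boolPair (codeOf I t d) (encList cs)) = [true] ↔
      ¬ ARVerifier.MAccepts I.basis t d (fun j : Fin (ARVerifier.nSamples I.n) => decodeIntVec I.n (cs.getD j [])) := by
  obtain ⟨b, hb, hiff⟩ := verdictF_eq_singleton I t d cs hn hcs
  rw [hb, ← hiff]
  simp

/-- **… and rejects iff the verifier accepts.** [cite: Regev2009, Lemma 3.20 (proof, p. 22)] -/
theorem verdictF_eq_false_iff :
    verdictF (boolPair (codeOf I t d) (encList cs)) = [false] ↔
      ARVerifier.MAccepts I.basis t d (fun j : Fin (ARVerifier.nSamples I.n) => decodeIntVec I.n (cs.getD j [])) := by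
  obtain ⟨b, hb, hiff⟩ := verdictF_eq_singleton I t d cs hn hcs
  rw [hb]
  cases b
  · have hM : ¬¬ ARVerifier.MAccepts I.basis t d (fun j : Fin (ARVerifier.nSamples I.n) => decodeIntVec I.n (cs.getD j [])) :=
      fun h => Bool.false_ne_true (hiff.2 h)
    simp only [true_iff]
    exact Classical.not_not.1 hM
  · have hM := hiff.1 rfl
    constructor
    · intro h; simp at h
    · intro h; exact absurd h hM

end Main

end ARMachine

end Literature.Algebra.EuclideanLattices

end
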